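import Summits.Ventures.PercRepro.C041TriDomExcessWeightedProb

/-!
# ROW C-041 — THE DELETION–CONTRACTION METHOD AT EVERY EDGE PROBABILITY (three marks)
(p6, gen 42; P6-TWOEXIT-LEAN.md §53 ADDENDUM 7)

The weighted recursion of `C041TriDomExcessWeighted` used two properties of `Fsym` only: THE KEY LEMMA's inequality
(`DCAdmissible`, with the diagonal zero) and the non-negativity on comparable pairs — which is itself a consequence of
THE KEY LEMMA for a SYMMETRIC functional (`DCAdmissible.nonneg_of_le3`: the same coarsening in both colours gives
`0 ≤ F s t + F t s`).  Here the recursion is run for an ARBITRARY admissible symmetric functional `F : P3 → P3 → ℤ`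
with forced-red edges `R`, statuses `st` and edge probabilities `w`: `sumFW F R st w = Σ_ω cwt w ω · F (rsigF R st ω)
(bsig st ω)`; **THE WEIGHTED RECURSION** `sumFW_rec_ge` and **THE METHOD AT EVERY EDGE PROBABILITY** `sumFW_nonneg`
(`w e ∈ [½, 1]`), `sumFW_free_nonneg` (the host with every edge free), the complementation `sumFW_free_cpl` and
`sumFW_free_nonneg_of_le_half` (`w e ∈ [0, ½]`).  Corollaries: every functional whose symmetrisation is admissible
(`sumFW_symF_free_nonneg`) — in particular the three FKG–complementation functionals `Ffkg`, `Ffkg2`, `Ffkg3` of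
`C041TriDomExcessMethod`, symmetrised, at every edge probability on one side of `½`: e.g.
  `P(⊤, uu′|a) + P(uu′|a, ⊤) + P(⊤,⊥) + P(⊥,⊤) ≥ P(au|u′ ; au′|u) + P(au′|u ; au|u′)`
(`probPat_fkg_sym_of_half_le`, `probPat_fkg_sym_of_le_half`) and its two images under the rotation of the marks.
-/

namespace PercRepro

namespace ZoneZ

namespace MultiExit

open ZoneData Finset

variable {V₁ E₁ U₁ U₂ : Type} (Z₁ : ZoneData V₁ E₁ U₁ U₂) (u u' a₁ : V₁)

/-! ## Admissible symmetric functionals are non-negative on comparable pairs -/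

/-- THE KEY LEMMA with the same coarsening in both colours: an admissible functional has `0 ≤ F s t + F t s` on
comparable pairs; for a symmetric one, `0 ≤ F s t`. -/
theorem DCAdmissible.nonneg_of_le3 {F : P3 → P3 → ℤ} (hF : DCAdmissible F)
    (hsym : ∀ s t, Trans3 s → Trans3 t → F s t = F t s) {s t : P3} (hs : Trans3 s) (ht : Trans3 t)
    (hle : Le3 t s) : 0 ≤ F s t := by
  have h := hF.key t s t s ⟨ht, hs, ht, hs, hle, hle⟩
  rw [hF.diag t ht, hF.diag s hs, hsym t s ht hs] at h
  linarith

/-- The symmetrisation of any functional is symmetric. -/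
theorem symF_comm (F : P3 → P3 → ℤ) (s t : P3) : symF F s t = symF F t s := by
  unfold symF; exact add_comm _ _

/-! ## The weighted sum of a functional with forced-red edges -/

variable [Fintype E₁] [DecidableEq E₁]

/-- The weighted sum of `F` at the forced red pattern and the blue pattern: the expectation of `F (π_R) (π_B)` under
the product measure with edge probabilities `w`, forced-red edges `R` and statuses `st`. -/
noncomputable def sumFW (F : P3 → P3 → ℤ) (R : E₁ → Prop) (st : E₁ → EStat) (w : E₁ → ℚ) : ℚ :=
  ∑ ω : E₁ → Bool, cwt w ω * (F (rsigF Z₁ u u' a₁ R st ω) (bsig Z₁ u u' a₁ st ω) : ℚ)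

/-- Colouring `f` red or blue: the two weighted summands of the recursion, for `F`. -/
theorem summandFW_add_flip (F : P3 → P3 → ℤ) (R : E₁ → Prop) (st : E₁ → EStat) (w : E₁ → ℚ) (f : E₁)
    (hf : st f = .free) (ω : E₁ → Bool) :
    cwt w ω * (F (rsigF Z₁ u u' a₁ R st ω) (bsig Z₁ u u' a₁ st ω) : ℚ)
        + cwt w (flipC f ω) * (F (rsigF Z₁ u u' a₁ R st (flipC f ω)) (bsig Z₁ u u' a₁ st (flipC f ω)) : ℚ) =
      cwt' f w ω * (w f * (F (rsigF Z₁ u u' a₁ R (Function.update st f .double) ω)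
          (bsig Z₁ u u' a₁ (Function.update st f .absent) ω) : ℚ)
        + (1 - w f) * (F (rsigF Z₁ u u' a₁ R (Function.update st f .absent) ω)
          (bsig Z₁ u u' a₁ (Function.update st f .double) ω) : ℚ)) := by
  have hd : EStat.double ≠ EStat.free := by decide
  have ha : EStat.absent ≠ EStat.free := by decide
  rw [cwt_eq f w ω, cwt_eq f w (flipC f ω), cwt'_flip, flipC_apply_self]
  by_cases hω : ω f = true
  · have hω' : flipC f ω f = false := by simp [flipC_apply_self, hω]
    rw [rsigF_of_true Z₁ u u' a₁ R hf hω, bsig_of_true Z₁ u u' a₁ hf hω, rsigF_of_false Z₁ u u' a₁ R hf hω',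
      bsig_of_false Z₁ u u' a₁ hf hω']
    unfold flipC
    rw [rsigF_update_nonfree Z₁ u u' a₁ R st f ha, bsig_update_nonfree Z₁ u u' a₁ st f hd]
    simp only [hω, wt, Bool.not_true, if_true, Bool.false_eq_true, if_false]
    ring
  · have hω0 : ω f = false := by simpa using hω
    have hω' : flipC f ω f = true := by simp [flipC_apply_self, hω0]
    rw [rsigF_of_false Z₁ u u' a₁ R hf hω0, bsig_of_false Z₁ u u' a₁ hf hω0, rsigF_of_true Z₁ u u' a₁ R hf hω',
      bsig_of_true Z₁ u u' a₁ hf hω']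
    unfold flipC
    rw [rsigF_update_nonfree Z₁ u u' a₁ R st f hd, bsig_update_nonfree Z₁ u u' a₁ st f ha]
    simp only [hω0, wt, Bool.not_false, if_true, Bool.false_eq_true, if_false]
    ring

/-- Twice the weighted sum at a free edge `f`, with the weight of `f` split off. -/
theorem two_mul_sumFW (F : P3 → P3 → ℤ) (R : E₁ → Prop) (st : E₁ → EStat) (w : E₁ → ℚ) (f : E₁)
    (hf : st f = .free) :
    2 * sumFW Z₁ u u' a₁ F R st w = ∑ ω : E₁ → Bool, cwt' f w ω *
      (w f * (F (rsigF Z₁ u u' a₁ R (Function.update st f .double) ω)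
          (bsig Z₁ u u' a₁ (Function.update st f .absent) ω) : ℚ)
        + (1 - w f) * (F (rsigF Z₁ u u' a₁ R (Function.update st f .absent) ω)
          (bsig Z₁ u u' a₁ (Function.update st f .double) ω) : ℚ)) := by
  have hflip : ∑ ω : E₁ → Bool, cwt w ω * (F (rsigF Z₁ u u' a₁ R st ω) (bsig Z₁ u u' a₁ st ω) : ℚ) =
      ∑ ω : E₁ → Bool, cwt w (flipC f ω) *
        (F (rsigF Z₁ u u' a₁ R st (flipC f ω)) (bsig Z₁ u u' a₁ st (flipC f ω)) : ℚ) :=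
    (Equiv.sum_comp (flipPerm f)
      (fun ω => cwt w ω * (F (rsigF Z₁ u u' a₁ R st ω) (bsig Z₁ u u' a₁ st ω) : ℚ))).symm
  have h2 : 2 * sumFW Z₁ u u' a₁ F R st w = ∑ ω : E₁ → Bool,
      (cwt w ω * (F (rsigF Z₁ u u' a₁ R st ω) (bsig Z₁ u u' a₁ st ω) : ℚ)
        + cwt w (flipC f ω) *
          (F (rsigF Z₁ u u' a₁ R st (flipC f ω)) (bsig Z₁ u u' a₁ st (flipC f ω)) : ℚ)) := by
    rw [Finset.sum_add_distrib, ← hflip, sumFW]; ring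
  rw [h2]
  exact Finset.sum_congr rfl fun ω _ => summandFW_add_flip Z₁ u u' a₁ F R st w f hf ω

/-- Twice the weighted sum of a status in which `f` is not free, with the weight of `f` removed. -/
theorem two_mul_sumFW_nonfree (F : P3 → P3 → ℤ) (R : E₁ → Prop) (st : E₁ → EStat) (w : E₁ → ℚ) (f : E₁)
    {s : EStat} (hs : s ≠ .free) :
    2 * sumFW Z₁ u u' a₁ F R (Function.update st f s) w = ∑ ω : E₁ → Bool, cwt' f w ω *
      (F (rsigF Z₁ u u' a₁ R (Function.update st f s) ω) (bsig Z₁ u u' a₁ (Function.update st f s) ω) : ℚ) := by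
  unfold sumFW
  refine two_mul_sum_cwt_eq f w _ fun ω => ?_
  unfold flipC
  rw [rsigF_update_nonfree Z₁ u u' a₁ R st f hs, bsig_update_nonfree Z₁ u u' a₁ st f hs]

/-- **THE WEIGHTED RECURSION** for an admissible `F` (as an inequality), at a free edge `f` of probability
`p = w f ∈ [0, 1]`. -/
theorem sumFW_rec_ge {F : P3 → P3 → ℤ} (hF : DCAdmissible F) (R : E₁ → Prop) (st : E₁ → EStat) (w : E₁ → ℚ)
    (hw : ∀ e, 0 ≤ w e ∧ w e ≤ 1) (f : E₁) (hf : st f = .free) :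
    (2 * w f - 1) * sumFW Z₁ u u' a₁ F (fun e => R e ∨ e = f) (Function.update st f .absent) w
      + (1 - w f) * (sumFW Z₁ u u' a₁ F R (Function.update st f .absent) w
        + sumFW Z₁ u u' a₁ F R (Function.update st f .double) w) ≤ sumFW Z₁ u u' a₁ F R st w := by
  have hd : EStat.double ≠ EStat.free := by decide
  have ha : EStat.absent ≠ EStat.free := by decide
  have hT := two_mul_sumFW Z₁ u u' a₁ F R st w f hf
  have hA := two_mul_sumFW_nonfree Z₁ u u' a₁ F R st w f ha
  have hD := two_mul_sumFW_nonfree Z₁ u u' a₁ F R st w f hd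
  have hF' := two_mul_sumFW_nonfree Z₁ u u' a₁ F (fun e => R e ∨ e = f) st w f ha
  simp only [rsigF_forced_eq Z₁ u u' a₁ R st f] at hF'
  have h1w : 0 ≤ 1 - w f := by linarith [(hw f).2]
  have hpt : ∑ ω : E₁ → Bool, cwt' f w ω * ((2 * w f - 1) *
        (F (rsigF Z₁ u u' a₁ R (Function.update st f .double) ω)
          (bsig Z₁ u u' a₁ (Function.update st f .absent) ω) : ℚ)
      + (1 - w f) * ((F (rsigF Z₁ u u' a₁ R (Function.update st f .absent) ω)
          (bsig Z₁ u u' a₁ (Function.update st f .absent) ω) : ℚ)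
        + (F (rsigF Z₁ u u' a₁ R (Function.update st f .double) ω)
          (bsig Z₁ u u' a₁ (Function.update st f .double) ω) : ℚ))) ≤
      ∑ ω : E₁ → Bool, cwt' f w ω *
      (w f * (F (rsigF Z₁ u u' a₁ R (Function.update st f .double) ω)
          (bsig Z₁ u u' a₁ (Function.update st f .absent) ω) : ℚ)
        + (1 - w f) * (F (rsigF Z₁ u u' a₁ R (Function.update st f .absent) ω)
          (bsig Z₁ u u' a₁ (Function.update st f .double) ω) : ℚ)) := by
    refine Finset.sum_le_sum fun ω _ => mul_le_mul_of_nonneg_left ?_ (cwt'_nonneg hw f ω)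
    have hg := hF.key _ _ _ _ ⟨trans3_rsigF Z₁ u u' a₁ R (Function.update st f .absent) ω,
      trans3_rsigF Z₁ u u' a₁ R (Function.update st f .double) ω,
      trans3_bsig Z₁ u u' a₁ (Function.update st f .absent) ω,
      trans3_bsig Z₁ u u' a₁ (Function.update st f .double) ω,
      le3_rsigF Z₁ u u' a₁ R st f ω, le3_bsig Z₁ u u' a₁ st f ω⟩
    have hg' : (0 : ℚ) ≤ (F (rsigF Z₁ u u' a₁ R (Function.update st f .double) ω)
          (bsig Z₁ u u' a₁ (Function.update st f .absent) ω) : ℚ)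
        + (F (rsigF Z₁ u u' a₁ R (Function.update st f .absent) ω)
          (bsig Z₁ u u' a₁ (Function.update st f .double) ω) : ℚ)
        - (F (rsigF Z₁ u u' a₁ R (Function.update st f .absent) ω)
          (bsig Z₁ u u' a₁ (Function.update st f .absent) ω) : ℚ)
        - (F (rsigF Z₁ u u' a₁ R (Function.update st f .double) ω)
          (bsig Z₁ u u' a₁ (Function.update st f .double) ω) : ℚ) := by
      have : (0 : ℤ) ≤ _ := sub_nonneg.mpr hg
      exact_mod_cast (by linarith : (0 : ℤ) ≤ F (rsigF Z₁ u u' a₁ R (Function.update st f .double) ω)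
          (bsig Z₁ u u' a₁ (Function.update st f .absent) ω)
        + F (rsigF Z₁ u u' a₁ R (Function.update st f .absent) ω)
          (bsig Z₁ u u' a₁ (Function.update st f .double) ω)
        - F (rsigF Z₁ u u' a₁ R (Function.update st f .absent) ω)
          (bsig Z₁ u u' a₁ (Function.update st f .absent) ω)
        - F (rsigF Z₁ u u' a₁ R (Function.update st f .double) ω)
          (bsig Z₁ u u' a₁ (Function.update st f .double) ω))
    nlinarith [mul_nonneg h1w hg']
  have hsplit : ∑ ω : E₁ → Bool, cwt' f w ω * ((2 * w f - 1) *
        (F (rsigF Z₁ u u' a₁ R (Function.update st f .double) ω)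
          (bsig Z₁ u u' a₁ (Function.update st f .absent) ω) : ℚ)
      + (1 - w f) * ((F (rsigF Z₁ u u' a₁ R (Function.update st f .absent) ω)
          (bsig Z₁ u u' a₁ (Function.update st f .absent) ω) : ℚ)
        + (F (rsigF Z₁ u u' a₁ R (Function.update st f .double) ω)
          (bsig Z₁ u u' a₁ (Function.update st f .double) ω) : ℚ))) =
      (2 * w f - 1) * ∑ ω : E₁ → Bool, cwt' f w ω *
        (F (rsigF Z₁ u u' a₁ R (Function.update st f .double) ω)
          (bsig Z₁ u u' a₁ (Function.update st f .absent) ω) : ℚ)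
      + (1 - w f) * (∑ ω : E₁ → Bool, cwt' f w ω *
          (F (rsigF Z₁ u u' a₁ R (Function.update st f .absent) ω)
            (bsig Z₁ u u' a₁ (Function.update st f .absent) ω) : ℚ)
        + ∑ ω : E₁ → Bool, cwt' f w ω *
          (F (rsigF Z₁ u u' a₁ R (Function.update st f .double) ω)
            (bsig Z₁ u u' a₁ (Function.update st f .double) ω) : ℚ)) := by
    rw [mul_add, Finset.mul_sum, Finset.mul_sum, Finset.mul_sum, ← Finset.sum_add_distrib,
      ← Finset.sum_add_distrib]
    exact Finset.sum_congr rfl fun ω _ => by ring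
  rw [hsplit, ← hF', ← hA, ← hD, ← hT] at hpt
  linarith

/-- **THE METHOD AT EVERY EDGE PROBABILITY**: for an admissible symmetric functional, every status, every forced-red
set and all edge probabilities in `[½, 1]`, the weighted sum is non-negative. -/
theorem sumFW_nonneg {F : P3 → P3 → ℤ} (hF : DCAdmissible F) (hsym : ∀ s t, Trans3 s → Trans3 t → F s t = F t s)
    (R : E₁ → Prop) (st : E₁ → EStat) (w : E₁ → ℚ) (hw : ∀ e, 1 / 2 ≤ w e ∧ w e ≤ 1) :
    0 ≤ sumFW Z₁ u u' a₁ F R st w := by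
  have hw01 : ∀ e, 0 ≤ w e ∧ w e ≤ 1 := fun e => ⟨by linarith [(hw e).1], (hw e).2⟩
  suffices h : ∀ n : ℕ, ∀ (R : E₁ → Prop) (st : E₁ → EStat), nfree st = n → 0 ≤ sumFW Z₁ u u' a₁ F R st w from
    h _ R st rfl
  intro n
  induction n with
  | zero =>
    intro R st hst
    have hno : ∀ e, st e ≠ .free := by
      intro e he
      have : e ∈ (univ.filter fun e => st e = .free) := by simp [he]
      rw [Finset.card_eq_zero.mp hst] at this
      simp at this
    unfold sumFW
    refine Finset.sum_nonneg fun ω _ => mul_nonneg (cwt_nonneg hw01 ω) ?_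
    exact_mod_cast hF.nonneg_of_le3 hsym (trans3_rsigF Z₁ u u' a₁ R st ω) (trans3_bsig Z₁ u u' a₁ st ω)
      (le3_bsig_rsigF_of_nofree Z₁ u u' a₁ R st hno ω)
  | succ n ih =>
    intro R st hst
    have hne : (univ.filter fun e => st e = .free).Nonempty := by
      rw [← Finset.card_pos]; unfold nfree at hst; omega
    obtain ⟨f, hf⟩ := hne
    have hf' : st f = .free := (Finset.mem_filter.mp hf).2
    have h1 := ih (fun e => R e ∨ e = f) (Function.update st f .absent) (by
      have := nfree_update hf' (s := .absent) (by decide); omega)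
    have h2 := ih R (Function.update st f .absent) (by
      have := nfree_update hf' (s := .absent) (by decide); omega)
    have h3 := ih R (Function.update st f .double) (by
      have := nfree_update hf' (s := .double) (by decide); omega)
    have hrec := sumFW_rec_ge Z₁ u u' a₁ hF R st w hw01 f hf'
    have hc1 : 0 ≤ 2 * w f - 1 := by linarith [(hw f).1]
    have hc2 : 0 ≤ 1 - w f := by linarith [(hw f).2]
    have := add_nonneg (mul_nonneg hc1 h1) (mul_nonneg hc2 (add_nonneg h2 h3))
    linarith

/-! ## The host with every edge free -/

/-- **THE METHOD AT EVERY EDGE PROBABILITY ≥ ½, ALL EDGES FREE**. -/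
theorem sumFW_free_nonneg {F : P3 → P3 → ℤ} (hF : DCAdmissible F)
    (hsym : ∀ s t, Trans3 s → Trans3 t → F s t = F t s) (w : E₁ → ℚ) (hw : ∀ e, 1 / 2 ≤ w e ∧ w e ≤ 1) :
    0 ≤ ∑ ω : E₁ → Bool, cwt w ω *
      (F (rsig Z₁ u u' a₁ (fun _ => EStat.free) ω) (bsig Z₁ u u' a₁ (fun _ => EStat.free) ω) : ℚ) := by
  have h := sumFW_nonneg Z₁ u u' a₁ hF hsym (fun _ => False) (fun _ => EStat.free) w hw
  unfold sumFW at h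
  simpa only [rsigF_false] using h

/-- The complementation: the weighted sum of a symmetric functional at `w` equals the one at `1 − w`. -/
theorem sumFW_free_cpl (F : P3 → P3 → ℤ) (hsym : ∀ s t, Trans3 s → Trans3 t → F s t = F t s) (w : E₁ → ℚ) :
    ∑ ω : E₁ → Bool, cwt w ω *
        (F (rsig Z₁ u u' a₁ (fun _ => EStat.free) ω) (bsig Z₁ u u' a₁ (fun _ => EStat.free) ω) : ℚ) =
      ∑ ω : E₁ → Bool, cwt (fun e => 1 - w e) ω *
        (F (rsig Z₁ u u' a₁ (fun _ => EStat.free) ω) (bsig Z₁ u u' a₁ (fun _ => EStat.free) ω) : ℚ) := by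
  have hinv : Function.Involutive (ZoneData.cpl (E := E₁)) := ZoneData.cpl_cpl
  rw [← Equiv.sum_comp hinv.toPerm (fun ω => cwt w ω *
    (F (rsig Z₁ u u' a₁ (fun _ => EStat.free) ω) (bsig Z₁ u u' a₁ (fun _ => EStat.free) ω) : ℚ))]
  refine Finset.sum_congr rfl fun ω _ => ?_
  simp only [Function.Involutive.coe_toPerm]
  rw [cwt_cpl, rsig_free_cpl, bsig_free_cpl,
    hsym _ _ (trans3_bsig Z₁ u u' a₁ _ ω) (trans3_rsig Z₁ u u' a₁ _ ω)]

/-- **THE METHOD AT EVERY EDGE PROBABILITY ≤ ½, ALL EDGES FREE** (by complementation). -/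
theorem sumFW_free_nonneg_of_le_half {F : P3 → P3 → ℤ} (hF : DCAdmissible F)
    (hsym : ∀ s t, Trans3 s → Trans3 t → F s t = F t s) (w : E₁ → ℚ) (hw : ∀ e, 0 ≤ w e ∧ w e ≤ 1 / 2) :
    0 ≤ ∑ ω : E₁ → Bool, cwt w ω *
      (F (rsig Z₁ u u' a₁ (fun _ => EStat.free) ω) (bsig Z₁ u u' a₁ (fun _ => EStat.free) ω) : ℚ) := by
  rw [sumFW_free_cpl Z₁ u u' a₁ F hsym]
  exact sumFW_free_nonneg Z₁ u u' a₁ hF hsym (fun e => 1 - w e) fun e =>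
    ⟨by linarith [(hw e).2], by linarith [(hw e).1]⟩

/-- Every functional whose symmetrisation is admissible gives a theorem at every edge probability ≥ ½, for its
symmetrisation. -/
theorem sumFW_symF_free_nonneg {F : P3 → P3 → ℤ} (hF : DCAdmissible (symF F)) (w : E₁ → ℚ)
    (hw : ∀ e, 1 / 2 ≤ w e ∧ w e ≤ 1) :
    0 ≤ ∑ ω : E₁ → Bool, cwt w ω *
      (symF F (rsig Z₁ u u' a₁ (fun _ => EStat.free) ω) (bsig Z₁ u u' a₁ (fun _ => EStat.free) ω) : ℚ) :=
  sumFW_free_nonneg Z₁ u u' a₁ hF (fun s t _ _ => symF_comm F s t) w hw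

/-- The same at every edge probability ≤ ½. -/
theorem sumFW_symF_free_nonneg_of_le_half {F : P3 → P3 → ℤ} (hF : DCAdmissible (symF F)) (w : E₁ → ℚ)
    (hw : ∀ e, 0 ≤ w e ∧ w e ≤ 1 / 2) :
    0 ≤ ∑ ω : E₁ → Bool, cwt w ω *
      (symF F (rsig Z₁ u u' a₁ (fun _ => EStat.free) ω) (bsig Z₁ u u' a₁ (fun _ => EStat.free) ω) : ℚ) :=
  sumFW_free_nonneg_of_le_half Z₁ u u' a₁ hF (fun s t _ _ => symF_comm F s t) w hw

/-! ## The FKG–complementation inequalities at every edge probability -/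

/-- The symmetrised FKG–complementation functional as indicators. -/
theorem symF_Ffkg_eq_ind : ∀ s t : P3, symF Ffkg s t =
    (if s = (true, true, true) ∧ t = (false, false, true) then 1 else 0)
      + (if s = (false, false, true) ∧ t = (true, true, true) then 1 else 0)
      + (if s = (true, true, true) ∧ t = (false, false, false) then 1 else 0)
      + (if s = (false, false, false) ∧ t = (true, true, true) then 1 else 0)
      - (if s = (true, false, false) ∧ t = (false, true, false) then 1 else 0)
      - (if s = (false, true, false) ∧ t = (true, false, false) then 1 else 0) := by
  decide

/-- The weighted symmetrised FKG–complementation sum in probabilities. -/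
theorem sum_cwt_symF_Ffkg_eq (w : E₁ → ℚ) :
    ∑ ω : E₁ → Bool, cwt w ω *
        (symF Ffkg (rsig Z₁ u u' a₁ (fun _ => EStat.free) ω) (bsig Z₁ u u' a₁ (fun _ => EStat.free) ω) : ℚ) =
      probPat Z₁ u u' a₁ w (true, true, true) (false, false, true)
        + probPat Z₁ u u' a₁ w (false, false, true) (true, true, true)
        + probPat Z₁ u u' a₁ w (true, true, true) (false, false, false)
        + probPat Z₁ u u' a₁ w (false, false, false) (true, true, true)
        - probPat Z₁ u u' a₁ w (true, false, false) (false, true, false)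
        - probPat Z₁ u u' a₁ w (false, true, false) (true, false, false) := by
  unfold probPat
  simp only [← Finset.sum_add_distrib, ← Finset.sum_sub_distrib]
  refine Finset.sum_congr rfl fun ω _ => ?_
  rw [symF_Ffkg_eq_ind]
  push_cast
  simp only [mul_add, mul_sub, mul_ite, mul_one, mul_zero]

/-- **THE FKG–COMPLEMENTATION INEQUALITY AT EVERY EDGE PROBABILITY ≥ ½ (apex `a`), SYMMETRISED, IN PROBABILITIES**:
`P(au|u′ ; au′|u) + P(au′|u ; au|u′) ≤ P(⊤, uu′|a) + P(uu′|a, ⊤) + P(⊤,⊥) + P(⊥,⊤)`. -/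
theorem probPat_fkg_sym_of_half_le (w : E₁ → ℚ) (hw : ∀ e, 1 / 2 ≤ w e ∧ w e ≤ 1) :
    probPat Z₁ u u' a₁ w (true, false, false) (false, true, false)
        + probPat Z₁ u u' a₁ w (false, true, false) (true, false, false) ≤
      probPat Z₁ u u' a₁ w (true, true, true) (false, false, true)
        + probPat Z₁ u u' a₁ w (false, false, true) (true, true, true)
        + probPat Z₁ u u' a₁ w (true, true, true) (false, false, false)
        + probPat Z₁ u u' a₁ w (false, false, false) (true, true, true) := by
  have h := sumFW_symF_free_nonneg Z₁ u u' a₁ dcAdmissible_symF_Ffkg w hw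
  rw [sum_cwt_symF_Ffkg_eq] at h
  linarith

/-- The same at every edge probability ≤ ½. -/
theorem probPat_fkg_sym_of_le_half (w : E₁ → ℚ) (hw : ∀ e, 0 ≤ w e ∧ w e ≤ 1 / 2) :
    probPat Z₁ u u' a₁ w (true, false, false) (false, true, false)
        + probPat Z₁ u u' a₁ w (false, true, false) (true, false, false) ≤
      probPat Z₁ u u' a₁ w (true, true, true) (false, false, true)
        + probPat Z₁ u u' a₁ w (false, false, true) (true, true, true)
        + probPat Z₁ u u' a₁ w (true, true, true) (false, false, false)
        + probPat Z₁ u u' a₁ w (false, false, false) (true, true, true) := by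
  have h := sumFW_symF_free_nonneg_of_le_half Z₁ u u' a₁ dcAdmissible_symF_Ffkg w hw
  rw [sum_cwt_symF_Ffkg_eq] at h
  linarith

end MultiExit

end ZoneZ

end PercRepro
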